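import Mathlib.Analysis.SpecialFunctions.Gaussian.FourierTransform
import Mathlib.MeasureTheory.Group.Integral
import Mathlib.MeasureTheory.Measure.Haar.Unique
import HarnessLib

/-!
# Laplace integrals at SECOND order: an ODD first-order term is invisible to a centred Gaussian (rate twin of `stub_boRate`, item (d) at rate grade)
# (route `FlatTubeReduction`, crux K1 `NearFlatRatioLaw` stmt-QuantumFields-24720, registered stub `stub_boRate` = FCL 23943's `BORateAll`; line «borate»;
# design note `Cruxes/NearFlatRatioLaw/Lines/borate-rate-uniformity-g7.md`; rung R2b1 = RECORD label)

Seat `ym-line-ftr-p1` g7 (prover).  Every Laplace evaluation of the chart programme (the Faddeev–Popov weight `N`, lane A `fpWeight_laplace_bounds`; the averaged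
kernel in the tube, owed item (d) of COARSE-DESIGN §23.5) integrates a centred Gaussian `exp(−‖A ξ‖²/s²)` against an amplitude `F(ξ) = 1 + ℓ(ξ) + O(‖ξ‖²)` whose first
order `ℓ` is ODD.  Bounding `|F − 1|` by `O(‖ξ‖)` gives relative precision `O(s)` (lane A's sandwiches, enough at `o(λ_b)`); using the parity of `ℓ` gives `O(s²)`, which is
what the rate twin needs (`s ≍ β^{-1/2}`: `s² = β^{-1} ≪ λ_b² ≍ β^{-2/3}`, while `s ≫ λ_b²`).  This file proves the abstract statement on a finite-dimensional real inner
product space `V` with Lebesgue measure: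
* `integral_mul_odd_eq_zero` — `w` even, `ℓ` odd ⇒ `∫ w·ℓ = 0` (no integrability needed; `volume` is negation invariant);
* `mul_exp_neg_le` — `t·e^{−t} ≤ (2/e)·e^{−t/2}`; `integrable_exp_neg_sq_norm_div` — Gaussians of coercive maps are integrable;
* ★★ `abs_integral_gaussian_mul_sub_le` — if `m‖ξ‖ ≤ ‖Aξ‖` (`m > 0`), `ℓ` is odd and `|F(ξ) − 1 − ℓ(ξ)| ≤ M‖ξ‖²`, then
  `|∫ e^{−‖Aξ‖²/s²} F(ξ) dξ − ∫ e^{−‖Aξ‖²/s²} dξ| ≤ M·(2s²/(e·m²))·∫ e^{−‖Aξ‖²/(2s²)} dξ`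
  — relative `O(s²)` (the last integral is `2^{dim V/2}` times the first, by `∫exp(−b‖Aξ‖²) = (π/b)^{d/2}/normDet A`, lane A `…GaussianLinear`; kept unevaluated here).
HONEST FRAMING: textbook calculus for the registered stub of a crux of the CONDITIONAL reduction route to the femto rung R2b1 (RECORD label); the amplitudes `F` it will be
applied to (gauge-orbit and kinetic Laplace integrands of the tube chart) are route RED lane A's, OPEN; nothing here is infinite volume, a continuum limit or the Clay mass gap.
No definitions, no `sorry`.

## References
* N. G. de Bruijn, *Asymptotic Methods in Analysis* (Dover 1981), §4.2 (Laplace's method; vanishing of odd moments) — [folklore].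
* B. Helffer, *Spectral Theory and its Applications*, CUP 2013, Lemma 7.1 — [cite: Helffer2013, Lemma 7.1 pp.77–78] (context: the kernel bounds these integrals feed).
-/

set_option autoImplicit false

noncomputable section

open MeasureTheory Real

namespace Summit.QuantumFields.YangMills.Theorems.FemtoTransferGap.FibredBO

variable {V W : Type*} [NormedAddCommGroup V] [InnerProductSpace ℝ V] [FiniteDimensional ℝ V] [MeasurableSpace V] [BorelSpace V]
  [NormedAddCommGroup W] [InnerProductSpace ℝ W]

/-- **Odd integrands against even weights vanish**: `w(−ξ) = w(ξ)`, `ℓ(−ξ) = −ℓ(ξ)` ⇒ `∫ w·ℓ dξ = 0` (Lebesgue measure on `V` is negation invariant; no integrability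
hypothesis — a non-integrable integrand has integral `0` on both sides of the change of variables). [folklore] -/
theorem integral_mul_odd_eq_zero {w ℓ : V → ℝ} (hw : ∀ ξ, w (-ξ) = w ξ) (hℓ : ∀ ξ, ℓ (-ξ) = -ℓ ξ) :
    ∫ ξ, w ξ * ℓ ξ = 0 := by
  have h1 : ∫ ξ, w (-ξ) * ℓ (-ξ) = ∫ ξ, w ξ * ℓ ξ := integral_neg_eq_self (fun ξ => w ξ * ℓ ξ) volume
  have h2 : ∫ ξ, w (-ξ) * ℓ (-ξ) = -∫ ξ, w ξ * ℓ ξ := by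
    rw [← integral_neg]
    exact integral_congr_ae (ae_of_all _ fun ξ => by
      show w (-ξ) * ℓ (-ξ) = -(w ξ * ℓ ξ)
      rw [hw, hℓ]; ring)
  linarith

/-- `t·e^{−t} ≤ (2/e)·e^{−t/2}` for every real `t` (from `1 + x ≤ eˣ` at `x = t/2 − 1`). [folklore] -/
theorem mul_exp_neg_le (t : ℝ) : t * exp (-t) ≤ 2 / exp 1 * exp (-t / 2) := by
  have h1 : t / 2 ≤ exp (t / 2) / exp 1 := by
    rw [← exp_sub]
    have := add_one_le_exp (t / 2 - 1)
    linarith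
  have h2 : t / 2 * exp 1 ≤ exp (t / 2) := (le_div_iff₀ (exp_pos 1)).mp h1
  have key : t ≤ 2 / exp 1 * exp (t / 2) := by
    rw [div_mul_eq_mul_div, le_div_iff₀ (exp_pos 1)]
    linarith
  calc t * exp (-t) ≤ (2 / exp 1 * exp (t / 2)) * exp (-t) := mul_le_mul_of_nonneg_right key (exp_pos _).le
    _ = 2 / exp 1 * (exp (t / 2) * exp (-t)) := by ring
    _ = 2 / exp 1 * exp (-t / 2) := by rw [← exp_add]; congr 1; ring

/-- The centred Gaussian of a coercive linear map is integrable. [folklore] -/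
theorem integrable_exp_neg_sq_norm_div (A : V →ₗ[ℝ] W) {m : ℝ} (hm : 0 < m) (hA : ∀ ξ, m * ‖ξ‖ ≤ ‖A ξ‖) {c : ℝ} (hc : 0 < c) :
    Integrable (fun ξ : V => exp (-(‖A ξ‖ ^ 2 / c))) := by
  have hg : Integrable (fun ξ : V => exp (-(m ^ 2 / c) * ‖ξ‖ ^ 2)) := by
    refine Integrable.of_integral_ne_zero ?_
    rw [GaussianFourier.integral_rexp_neg_mul_sq_norm (by positivity)]
    positivity
  refine hg.mono ?_ (ae_of_all _ fun ξ => ?_)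
  · have : Continuous fun ξ : V => exp (-(‖A ξ‖ ^ 2 / c)) := by
      have hAc : Continuous A := A.continuous_of_finiteDimensional
      fun_prop
    exact this.aestronglyMeasurable
  · rw [Real.norm_eq_abs, Real.norm_eq_abs, abs_of_pos (exp_pos _), abs_of_pos (exp_pos _), exp_le_exp]
    have h := hA ξ
    have h0 : 0 ≤ m * ‖ξ‖ := by positivity
    have h2 : (m * ‖ξ‖) ^ 2 ≤ ‖A ξ‖ ^ 2 := pow_le_pow_left₀ h0 h 2
    have h3 : m ^ 2 / c * ‖ξ‖ ^ 2 ≤ ‖A ξ‖ ^ 2 / c := by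
      rw [div_mul_eq_mul_div, div_le_div_iff_of_pos_right hc]
      nlinarith
    linarith

/-- ★★ **Laplace at second order: an odd first-order amplitude is invisible.**  Let `A : V → W` be linear and coercive (`m‖ξ‖ ≤ ‖Aξ‖`, `m > 0`), `s > 0`, and let the
amplitude `F` satisfy `|F(ξ) − 1 − ℓ(ξ)| ≤ M‖ξ‖²` (`M ≥ 0`) with `ℓ` ODD (integrability of the two Gaussian integrands involving `F`, `ℓ` assumed).  Then
`|∫ e^{−‖Aξ‖²/s²} F − ∫ e^{−‖Aξ‖²/s²}| ≤ M·(2s²/(e·m²))·∫ e^{−‖Aξ‖²/(2s²)}` — the relative error is `O(s²)`, not `O(s)`. [folklore] -/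
theorem abs_integral_gaussian_mul_sub_le (A : V →ₗ[ℝ] W) {m s M : ℝ} (hm : 0 < m) (hA : ∀ ξ, m * ‖ξ‖ ≤ ‖A ξ‖) (hs : 0 < s)
    (hM : 0 ≤ M) {F ℓ : V → ℝ} (hℓ : ∀ ξ, ℓ (-ξ) = -ℓ ξ) (hF : ∀ ξ, |F ξ - 1 - ℓ ξ| ≤ M * ‖ξ‖ ^ 2)
    (hFi : Integrable (fun ξ : V => exp (-(‖A ξ‖ ^ 2 / s ^ 2)) * F ξ))
    (hℓi : Integrable (fun ξ : V => exp (-(‖A ξ‖ ^ 2 / s ^ 2)) * ℓ ξ)) :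
    |(∫ ξ, exp (-(‖A ξ‖ ^ 2 / s ^ 2)) * F ξ) - ∫ ξ, exp (-(‖A ξ‖ ^ 2 / s ^ 2))|
      ≤ M * (2 * s ^ 2 / (exp 1 * m ^ 2)) * ∫ ξ, exp (-(‖A ξ‖ ^ 2 / (2 * s ^ 2))) := by
  -- Gaussian integrability (both widths)
  have hG : Integrable (fun ξ : V => exp (-(‖A ξ‖ ^ 2 / s ^ 2))) := integrable_exp_neg_sq_norm_div A hm hA (by positivity)
  have hG2 : Integrable (fun ξ : V => exp (-(‖A ξ‖ ^ 2 / (2 * s ^ 2)))) := integrable_exp_neg_sq_norm_div A hm hA (by positivity)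
  -- the pointwise second-moment bound: `‖ξ‖² e^{-Q} ≤ (2s²/(e m²)) e^{-Q/2}`
  have hmom : ∀ ξ : V, ‖ξ‖ ^ 2 * exp (-(‖A ξ‖ ^ 2 / s ^ 2)) ≤ (2 * s ^ 2 / (exp 1 * m ^ 2)) * exp (-(‖A ξ‖ ^ 2 / (2 * s ^ 2))) := by
    intro ξ
    set t := ‖A ξ‖ ^ 2 / s ^ 2 with htdef
    have key := mul_exp_neg_le t
    have e1 : exp (-(‖A ξ‖ ^ 2 / (2 * s ^ 2))) = exp (-t / 2) := by rw [htdef]; congr 1; ring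
    have hξ : ‖ξ‖ ^ 2 ≤ (s ^ 2 / m ^ 2) * t := by
      have h := hA ξ
      have h0 : 0 ≤ m * ‖ξ‖ := by positivity
      have h2 : (m * ‖ξ‖) ^ 2 ≤ ‖A ξ‖ ^ 2 := pow_le_pow_left₀ h0 h 2
      rw [htdef, div_mul_div_comm, le_div_iff₀ (by positivity)]
      nlinarith
    rw [e1]
    calc ‖ξ‖ ^ 2 * exp (-t) ≤ (s ^ 2 / m ^ 2) * t * exp (-t) := mul_le_mul_of_nonneg_right hξ (exp_pos _).le
      _ = (s ^ 2 / m ^ 2) * (t * exp (-t)) := by ring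
      _ ≤ (s ^ 2 / m ^ 2) * (2 / exp 1 * exp (-t / 2)) := mul_le_mul_of_nonneg_left key (by positivity)
      _ = (2 * s ^ 2 / (exp 1 * m ^ 2)) * exp (-t / 2) := by field_simp
  -- integrability of the second-order remainder against the Gaussian
  have hRi : Integrable (fun ξ : V => exp (-(‖A ξ‖ ^ 2 / s ^ 2)) * (F ξ - 1 - ℓ ξ)) := by
    have e : (fun ξ : V => exp (-(‖A ξ‖ ^ 2 / s ^ 2)) * (F ξ - 1 - ℓ ξ)) =
        fun ξ => (exp (-(‖A ξ‖ ^ 2 / s ^ 2)) * F ξ - exp (-(‖A ξ‖ ^ 2 / s ^ 2))) - exp (-(‖A ξ‖ ^ 2 / s ^ 2)) * ℓ ξ := by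
      funext ξ; ring
    have i1 : Integrable (fun ξ : V => exp (-(‖A ξ‖ ^ 2 / s ^ 2)) * F ξ - exp (-(‖A ξ‖ ^ 2 / s ^ 2))) := hFi.sub hG
    rw [e]; exact i1.sub hℓi
  -- split: ∫ e^{-Q}F − ∫ e^{-Q} = ∫ e^{-Q}(F − 1 − ℓ) + ∫ e^{-Q}ℓ, the last = 0
  have hodd : ∫ ξ : V, exp (-(‖A ξ‖ ^ 2 / s ^ 2)) * ℓ ξ = 0 :=
    integral_mul_odd_eq_zero (fun ξ => by rw [map_neg, norm_neg]) hℓ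
  have hsplit : (∫ ξ, exp (-(‖A ξ‖ ^ 2 / s ^ 2)) * F ξ) - ∫ ξ, exp (-(‖A ξ‖ ^ 2 / s ^ 2)) =
      ∫ ξ, exp (-(‖A ξ‖ ^ 2 / s ^ 2)) * (F ξ - 1 - ℓ ξ) := by
    rw [← integral_sub hFi hG]
    have e : ∫ ξ, exp (-(‖A ξ‖ ^ 2 / s ^ 2)) * (F ξ - 1 - ℓ ξ) =
        ∫ ξ, ((exp (-(‖A ξ‖ ^ 2 / s ^ 2)) * F ξ - exp (-(‖A ξ‖ ^ 2 / s ^ 2))) - exp (-(‖A ξ‖ ^ 2 / s ^ 2)) * ℓ ξ) :=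
      integral_congr_ae (ae_of_all _ fun ξ => by ring)
    have i1 : Integrable (fun ξ : V => exp (-(‖A ξ‖ ^ 2 / s ^ 2)) * F ξ - exp (-(‖A ξ‖ ^ 2 / s ^ 2))) := hFi.sub hG
    rw [e, integral_sub i1 hℓi, hodd, sub_zero]
  rw [hsplit]
  -- bound the remainder integral
  have hdom : Integrable (fun ξ : V => M * ((2 * s ^ 2 / (exp 1 * m ^ 2)) * exp (-(‖A ξ‖ ^ 2 / (2 * s ^ 2))))) := (hG2.const_mul _).const_mul M
  have hpt : ∀ ξ : V, ‖exp (-(‖A ξ‖ ^ 2 / s ^ 2)) * (F ξ - 1 - ℓ ξ)‖ ≤ M * ((2 * s ^ 2 / (exp 1 * m ^ 2)) * exp (-(‖A ξ‖ ^ 2 / (2 * s ^ 2)))) := by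
    intro ξ
    rw [Real.norm_eq_abs, abs_mul, abs_of_pos (exp_pos _)]
    calc exp (-(‖A ξ‖ ^ 2 / s ^ 2)) * |F ξ - 1 - ℓ ξ| ≤ exp (-(‖A ξ‖ ^ 2 / s ^ 2)) * (M * ‖ξ‖ ^ 2) :=
          mul_le_mul_of_nonneg_left (hF ξ) (exp_pos _).le
      _ = M * (‖ξ‖ ^ 2 * exp (-(‖A ξ‖ ^ 2 / s ^ 2))) := by ring
      _ ≤ M * ((2 * s ^ 2 / (exp 1 * m ^ 2)) * exp (-(‖A ξ‖ ^ 2 / (2 * s ^ 2)))) := mul_le_mul_of_nonneg_left (hmom ξ) hM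
  refine (Real.norm_eq_abs _ ▸ norm_integral_le_of_norm_le hdom (ae_of_all _ hpt)).trans (le_of_eq ?_)
  rw [integral_const_mul, integral_const_mul, mul_assoc]

end Summit.QuantumFields.YangMills.Theorems.FemtoTransferGap.FibredBO

end
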